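import Mathlib.Analysis.InnerProductSpace.GramSchmidtOrtho
import Literature.Algebra.EuclideanLattices.SuccessiveMinima
import HarnessLib

-- provenance: harness21/H21/H21/Prelude/Lattice/LLL.lean @ ec52c55 (interim HEAD d8f2665); M5 mechanical rewrite
/-!
# LLL-reduced bases

Trunk: Lattice (item `LLLReduced`, concept C7 of the Lattice outline).

Let `E` be a real inner product space and `b : ι → E` a family of vectors indexed by a
well-ordered, locally finite type (typically `ι = Fin n`), with Gram–Schmidt orthogonalisation
`b* := InnerProductSpace.gramSchmidt ℝ b` (Mathlib). We define

* `Literature.Lattice.gsCoeff b i j = μᵢⱼ := ⟪b i, b* j⟫ / ‖b* j‖²`, the Gram–Schmidt coefficients;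
* `Literature.Lattice.IsSizeReduced b` : `|μᵢⱼ| ≤ 1/2` for all `j < i`;
* `Literature.Lattice.LovaszCondition δ b` : `δ ‖b*ᵢ‖² ≤ ‖b*ᵢ₊₁ + μᵢ₊₁,ᵢ b*ᵢ‖²` for all `i` with `i + 1 < n`
  (here `ι = Fin n`);
* `Literature.Lattice.IsLLLReduced δ b := IsSizeReduced b ∧ LovaszCondition δ b`.

These are conditions (1.4)–(1.5) of A. K. Lenstra, H. W. Lenstra Jr., L. Lovász, *Factoring
polynomials with rational coefficients*, Math. Ann. 261 (1982) (LLL82), where classically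
`δ = 3/4`. We then state the basic consequences LLL82 (1.7)–(1.8) (Prop. 1.6) and the
ingredient `λ₁(L) ≥ minᵢ ‖b*ᵢ‖` of LLL82 Prop. 1.11, with `sorry` proofs.

Mathlib has the Gram–Schmidt process (`InnerProductSpace.gramSchmidt`, `gramSchmidt_def''`,
`gramSchmidt_orthogonal`, `span_gramSchmidt`, `gramSchmidt_ne_zero`) but no notion of size-reduced
or LLL-reduced family (searched: `LLL`, `Lovasz`, `SizeReduced`, `sizeReduced`); the coefficient
`μᵢⱼ` appears only inline in `gramSchmidt_def''` (as `⟪b* j, b i⟫ / ‖b* j‖²`, which agrees with our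
`gsCoeff` over `ℝ` by symmetry of the real inner product).

Design choices:
* No algorithm is formalised (outline D7): `IsLLLReduced` is a predicate on a family `b`; no
  linear independence is built in (it is a hypothesis of the lemmas that need it). Statements
  about a `LatticeInstance I` instantiate `b := I.vec`.
* `gsCoeff` and `IsSizeReduced` are stated for a general index type as in Mathlib's `gramSchmidt`;
  the Lovász condition compares consecutive indices and is stated for `Fin n`.
* Junk value: `gsCoeff b i j = 0` when `b* j = 0` (division by zero), harmless since then the
  corresponding Gram–Schmidt summand vanishes as well.
* Only the last lemma `minNorm_span_ge_iInf_norm_gramSchmidt` uses `Literature.Prelude.Lattice.SuccessiveMinima`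
  (for `minNorm`); the predicate part depends on Mathlib only.
-/

noncomputable section

open Finset Module InnerProductSpace
open scoped RealInnerProductSpace

namespace Literature.Algebra.EuclideanLattices

section General

variable {E : Type*} [NormedAddCommGroup E] [InnerProductSpace ℝ E]
variable {ι : Type*} [LinearOrder ι] [LocallyFiniteOrderBot ι] [WellFoundedLT ι]

/-- The Gram–Schmidt coefficient `μᵢⱼ = ⟪bᵢ, b*ⱼ⟫ / ‖b*ⱼ‖²` of a family `b`, where
`b* = gramSchmidt ℝ b`. Junk value `0` if `b*ⱼ = 0`.
Ref: LLL82 (Lenstra–Lenstra–Lovász, Math. Ann. 261 (1982)), (1.2). [folklore] -/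
def gsCoeff (b : ι → E) (i j : ι) : ℝ :=
  ⟪b i, gramSchmidt ℝ b j⟫_ℝ / ‖gramSchmidt ℝ b j‖ ^ 2

/-- A family `b` is *size-reduced* if all its Gram–Schmidt coefficients below the diagonal
satisfy `|μᵢⱼ| ≤ 1/2` (`j < i`). Ref: LLL82, condition (1.4). [folklore] -/
def IsSizeReduced (b : ι → E) : Prop :=
  ∀ i j : ι, j < i → |gsCoeff b i j| ≤ 1 / 2

/-- Gram–Schmidt decomposition `bᵢ = b*ᵢ + ∑_{j<i} μᵢⱼ b*ⱼ` (LLL82 (1.2)); this is Mathlib's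
`InnerProductSpace.gramSchmidt_def''` rewritten with `gsCoeff`. [folklore] -/
theorem self_eq_gramSchmidt_add_sum (b : ι → E) (i : ι) :
    b i = gramSchmidt ℝ b i + ∑ j ∈ Iio i, gsCoeff b i j • gramSchmidt ℝ b j := by
  conv_lhs => rw [gramSchmidt_def'' ℝ b i]
  simp only [gsCoeff, real_inner_comm, RCLike.ofReal_real_eq_id, id_eq]

/-- The diagonal Gram–Schmidt coefficient is `1` when `b*ᵢ ≠ 0`: `⟪bᵢ, b*ᵢ⟫ = ‖b*ᵢ‖²`.
Ref: LLL82 (1.2) (standard). [cite: LenstraLenstraLovasz1982, (1.2)] -/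
def gsCoeff_self : Prop :=
  ∀ (b : ι → E) (i : ι) (h : gramSchmidt ℝ b i ≠ 0),
    gsCoeff b i i = 1

/-- `μᵢⱼ = 0` for `i < j`: `bᵢ` lies in the span of `b*ₖ`, `k ≤ i`, which is orthogonal to `b*ⱼ`.
Ref: LLL82 (1.2) (standard). [cite: LenstraLenstraLovasz1982, (1.2)] -/
def gsCoeff_eq_zero_of_lt : Prop :=
  ∀ (b : ι → E) {i j : ι} (h : i < j),
    gsCoeff b i j = 0

end General

section Fin

variable {E : Type*} [NormedAddCommGroup E] [InnerProductSpace ℝ E] {n : ℕ}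

/-- The *Lovász condition* with parameter `δ` for a family `b : Fin n → E`:
`δ ‖b*ᵢ‖² ≤ ‖b*ᵢ₊₁ + μᵢ₊₁,ᵢ b*ᵢ‖²` for all consecutive indices `i, i+1 < n`.
Ref: LLL82, condition (1.5) (with `δ = 3/4`). [folklore] -/
def LovaszCondition (δ : ℝ) (b : Fin n → E) : Prop :=
  ∀ (i : Fin n) (h : (i : ℕ) + 1 < n),
    δ * ‖gramSchmidt ℝ b i‖ ^ 2 ≤
      ‖gramSchmidt ℝ b ⟨i + 1, h⟩ + gsCoeff b ⟨i + 1, h⟩ i • gramSchmidt ℝ b i‖ ^ 2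

/-- A family `b : Fin n → E` is *LLL-reduced* with parameter `δ` if it is size-reduced and
satisfies the Lovász condition with parameter `δ`. Classically `δ = 3/4`; the notion is useful
for `1/4 < δ < 1`. Ref: LLL82, (1.4)–(1.5). [folklore] -/
def IsLLLReduced (δ : ℝ) (b : Fin n → E) : Prop :=
  IsSizeReduced b ∧ LovaszCondition δ b

namespace IsLLLReduced

variable {δ : ℝ} {b : Fin n → E}

/-- An LLL-reduced family is size-reduced. Ref: LLL82 (1.4). [folklore] -/
theorem isSizeReduced (h : IsLLLReduced δ b) : IsSizeReduced b := h.1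

/-- An LLL-reduced family satisfies the Lovász condition. Ref: LLL82 (1.5). [folklore] -/
theorem lovaszCondition (h : IsLLLReduced δ b) : LovaszCondition δ b := h.2

/-- For an LLL-reduced family, consecutive Gram–Schmidt vectors satisfy
`(δ - 1/4) ‖b*ᵢ‖² ≤ ‖b*ᵢ₊₁‖²` (from the Lovász condition, orthogonality and `|μᵢ₊₁,ᵢ| ≤ 1/2`).
Ref: LLL82, proof of Prop. 1.6 (there with `δ = 3/4`, giving `‖b*ᵢ₊₁‖² ≥ ½ ‖b*ᵢ‖²`). [cite: LenstraLenstraLovasz1982, proof of Prop. 1.6] -/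
def sq_norm_gramSchmidt_succ_ge : Prop :=
  ∀ (h : IsLLLReduced δ b) (i : Fin n) (hi : (i : ℕ) + 1 < n),
    (δ - 1 / 4) * ‖gramSchmidt ℝ b i‖ ^ 2 ≤ ‖gramSchmidt ℝ b ⟨i + 1, hi⟩‖ ^ 2

/-- LLL82 (1.7), Gram–Schmidt part, for `δ = 3/4`: `‖b*ⱼ‖² ≤ 2^{i-j} ‖b*ᵢ‖²` for `j ≤ i`
(the exponent `i - j` is a natural-number subtraction, legitimate under `j ≤ i`).
Ref: LLL82, Prop. 1.6, proof. [cite: LenstraLenstraLovasz1982, proof of Prop. 1.6] -/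
def sq_norm_gramSchmidt_le_two_pow_mul : Prop :=
  ∀ (h : IsLLLReduced (3 / 4) b) {i j : Fin n} (hji : j ≤ i),
    ‖gramSchmidt ℝ b j‖ ^ 2 ≤ 2 ^ ((i : ℕ) - j) * ‖gramSchmidt ℝ b i‖ ^ 2

/-- LLL82 (1.7) for `δ = 3/4`: `‖bⱼ‖² ≤ 2^{i} ‖b*ᵢ‖²` for `j ≤ i` (indices from `0`; LLL82 writes
`2^{i-1}` with indices from `1`). Ref: LLL82, Prop. 1.6 (1.7). [cite: LenstraLenstraLovasz1982, Prop. 1.6 (1.7)] -/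
def sq_norm_le_two_pow_mul : Prop :=
  ∀ (h : IsLLLReduced (3 / 4) b) {i j : Fin n} (hji : j ≤ i),
    ‖b j‖ ^ 2 ≤ 2 ^ (i : ℕ) * ‖gramSchmidt ℝ b i‖ ^ 2

/-- LLL82 (1.8) for `δ = 3/4` and a linearly independent family: `∏ᵢ ‖bᵢ‖ ≤ 2^{n(n-1)/4} ∏ᵢ ‖b*ᵢ‖`
(the right-hand product being the lattice determinant `d(L)`).
Ref: LLL82, Prop. 1.6 (1.8). [cite: LenstraLenstraLovasz1982, Prop. 1.6 (1.8)] -/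
def prod_norm_le_two_pow_mul_prod_norm_gramSchmidt : Prop :=
  ∀ (h : IsLLLReduced (3 / 4) b),
    ∏ i, ‖b i‖ ≤ 2 ^ ((n : ℝ) * (n - 1) / 4) * ∏ i, ‖gramSchmidt ℝ b i‖

/-- LLL82 (1.9) ingredient for `δ = 3/4`: `‖b₀‖² ≤ 2^{i} ‖b*ᵢ‖²` for every `i`, hence
`‖b₀‖² ≤ 2^{n-1} minᵢ ‖b*ᵢ‖²`; combined with `minNorm_span_ge_iInf_norm_gramSchmidt` this yields
LLL82 Prop. 1.11, `‖b₀‖² ≤ 2^{n-1} λ₁(L)²`. Ref: LLL82, Prop. 1.6 / 1.11. [folklore] -/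
def sq_norm_zero_le_two_pow_mul : Prop :=
  ∀ (h : IsLLLReduced (3 / 4) b) (i : Fin n) (hn : 0 < n),
    ‖b ⟨0, hn⟩‖ ^ 2 ≤ 2 ^ (i : ℕ) * ‖gramSchmidt ℝ b i‖ ^ 2

/- interim proof relied on results that are now named facts (D-0014); demoted to a fact by the M5 import, proof preserved:
:=
  h.sq_norm_le_two_pow_mul (Fin.mk_le_of_le_val (Nat.zero_le _))
-/

end IsLLLReduced

/-- For a linearly independent family `b : Fin n → E`, every nonzero vector of the lattice
`L = ∑ ℤ bᵢ` has norm at least `minᵢ ‖b*ᵢ‖`; hence `minᵢ ‖b*ᵢ‖ ≤ λ₁(L)`. (For `n = 0` both sides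
are the junk value `0`.) Ref: LLL82, proof of Prop. 1.11 ((1.10)–(1.11));
Micciancio–Goldwasser, *Complexity of Lattice Problems*, Thm. 1.1. [cite: LenstraLenstraLovasz1982, proof of Prop. 1.11 ((1.10)–(1.11))] -/
def minNorm_span_ge_iInf_norm_gramSchmidt : Prop :=
  ∀ (b : Fin n → E) (hb : LinearIndependent ℝ b),
    ⨅ i, ‖gramSchmidt ℝ b i‖ ≤ minNorm (Submodule.span ℤ (Set.range b))

end Fin

end Literature.Algebra.EuclideanLattices
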